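import Summits.CriticalPhenomena.PercolationContinuityZ3.Theorems.Transplant.GrigorchukPowerNcHaraSladeDefs
import Summits.CriticalPhenomena.PercolationContinuityZ3.Theorems.Transplant.GrigorchukPowerWalkProduct
import HarnessLib

/-!
# W4 stub `stub_smallParam` DISCHARGED: the small parameter `p^{(k)}_4(e, e) ≤ 16 / k²` on `Cay(𝔊^k; std)` — KERNEL, unconditional

Proof file (`--supports stmt-CriticalPhenomena-4575 --as helper`), lane `prim-bschramm`, seat `prim-bschramm-gen-1` gen 12 (GEN pen); item E4.1 of the lead's
allocation (lead g29, bus 2026-08-29 #9731) on the W4 SKELETON OF RECORD v1.1 98f98c28 («HOME/w-ideation/W4/NcHaraSladeGk_birth.lean», stub `stub_smallParam :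
SmallParam`, size S), over DEFS-A «GrigorchukPowerNcHaraSladeDefs» (`simpleStep`, `SmallParam (A)`) and the walk PRODUCT FORMULA «GrigorchukPowerWalkProduct»
(p688765).  builds on p205010 (kernel theorem, internal audit signed; external expert review pending) — nothing here uses p205010.  Def-free; no instance, no
notation, no sorry, no `@[conjecture]`.  NOTHING here claims `θ(p_c) = 0` or an infrared bound on any `Cay(𝔊^k)`; this is the one stub of the W4 skeleton that
is pure walk combinatorics.

THE ARGUMENT.  (§1, generic, namespace `…Transplant.WalkCount`) On a `d`-regular graph the walk counts satisfy `W(n)(x, y) ≤ dⁿ` (`card_walks_le_pow`), there is no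
closed walk of length `1` (`card_walks_one_self`, no loops), and the simple-random-walk kernel of DEFS-A is `p_n(x, y) = W(n)(x, y)/dⁿ` (`simpleStep_eq_card_walks_div`,
induction over «GrigorchukPowerWalkProduct» `card_walks_succ`).  (§2) On `Cay(𝔊^k; std)` (`4k`-regular, p687152) the BOUND FORM of the product formula
(«GrigorchukPowerWalkProduct» `card_closedWalks_gkCay_le`) with the base bound `W_𝔊(m)(x,x) ≤ 4^m·b(m)`, `b(1) = 0` (no loops in `Cay(𝔊; a,b,c,d)`), `b(m) = 1`
otherwise (`4`-regularity, p682867 `stdCay_degree`), gives `W_{𝔊^k}(4)(e,e) ≤ 4⁴ · #{f : Fin 4 → Fin k with no coordinate used exactly once}`; such an allocation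
uses at most TWO coordinates (`4 = Σ_i N_i`, every used `N_i ≥ 2`), so their number is `≤ Σ_{(i,j)} #{f | ∀ t, f t ∈ {i, j}} ≤ k²·2⁴` (`sum_prod_noSingleton_le`).
Hence **`p^{(k)}_4(e,e) = W(4)/(4k)⁴ ≤ 256·16k²/(256 k⁴) = 16/k²`**: `smallParam_sixteen : SmallParam 16`, `smallParam_holds : ∃ A, SmallParam A` — the skeleton's
`stub_smallParam` in its binder-repaired reading (p3 g42 b2).
[cite: Woess2000, §1.B (p⁽ⁿ⁾ and walk counts)] [cite: BenjaminiSchramm1996, §2 (Cayley graphs)] [cite: HeydenreichVanDerHofstad2017, §5.2 (random-walk quantities; the small parameter 1/(2d))]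
-/

noncomputable section

namespace Summit.CriticalPhenomena.PercolationContinuityZ3.Theorems.Transplant

open SimpleGraph Finset

/-! ## §1 Generic: walk counts on a regular graph and the simple-random-walk kernel -/

namespace WalkCount

variable {V : Type*} (G : SimpleGraph V) [DecidableEq V] [G.LocallyFinite]

/-- **`W(n)(x, y) ≤ dⁿ` on a `d`-regular graph** (all walks of length `n` from `x` number `dⁿ`). [cite: Woess2000, §1.B] -/
theorem card_walks_le_pow {d : ℕ} (hG : G.IsRegularOfDegree d) (n : ℕ) (x y : V) :
    Fintype.card {p : G.Walk x y // p.length = n} ≤ d ^ n := by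
  induction n generalizing x with
  | zero => rw [card_walks_zero]; split_ifs <;> simp
  | succ n ih =>
    rw [card_walks_succ]
    calc ∑ w ∈ G.neighborFinset x, Fintype.card {p : G.Walk w y // p.length = n} ≤ ∑ _w ∈ G.neighborFinset x, d ^ n :=
          Finset.sum_le_sum fun w _ => ih w
      _ = d ^ (n + 1) := by rw [Finset.sum_const, card_neighborFinset_eq_degree, hG x, smul_eq_mul, pow_succ, mul_comm]

/-- **No closed walk of length one** (a simple graph has no loops). [folklore] -/
theorem card_walks_one_self (x : V) : Fintype.card {p : G.Walk x x // p.length = 1} = 0 := by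
  rw [card_walks_succ]
  refine Finset.sum_eq_zero fun w hw => ?_
  rw [card_walks_zero, if_neg]
  exact ((G.mem_neighborFinset x w).1 hw).ne'

end WalkCount

namespace Grigorchuk

namespace NcHaraSlade

open WalkCount
open scoped Classical

/-- **The simple-random-walk kernel is the normalised walk count on a regular graph**: `p_n(x, y) = W(n)(x, y)/dⁿ` for a `d`-regular graph with `d > 0`
(DEFS-A `simpleStep` against «GrigorchukPowerWalkProduct»'s walk recursion; the `DecidableEq` instance is the caller's, so the walk-count term matches the product
formula's). [cite: Woess2000, §1.B (p⁽ⁿ⁾ and walk counts)] -/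
theorem simpleStep_eq_card_walks_div {V : Type} [DecidableEq V] (G : SimpleGraph V) [G.LocallyFinite] {d : ℕ} (hG : G.IsRegularOfDegree d) (hd : 0 < d)
    (n : ℕ) (x y : V) :
    simpleStep G n x y = (Fintype.card {p : G.Walk x y // p.length = n} : ℝ) / (d : ℝ) ^ n := by
  induction n generalizing x with
  | zero =>
    rw [simpleStep_zero, card_walks_zero]
    split_ifs <;> simp
  | succ n ih =>
    rw [simpleStep_succ, card_walks_succ, Nat.cast_sum, Finset.sum_div]
    refine Finset.sum_congr rfl fun z _ => ?_
    rw [ih z, ← card_neighborFinset_eq_degree, card_neighborFinset_eq_degree, hG x, pow_succ]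
    have hd' : (d : ℝ) ≠ 0 := by exact_mod_cast hd.ne'
    field_simp

/-! ## §2 Allocations of four steps with no coordinate used exactly once -/

/-- **At most `16 k²` allocations `f : Fin 4 → Fin k` use no coordinate exactly once** — such an `f` takes at most two values (`4 = Σ_i N_i(f)` with every
used `N_i ≥ 2`), and for each pair `(i, j)` at most `2⁴` maps take values in `{i, j}`.  Stated for the weight `b(m) = [m ≠ 1]` of the product formula's bound form.
[folklore] -/
theorem sum_prod_noSingleton_le (k : ℕ) :
    (∑ f : Fin 4 → Fin k, ∏ i : Fin k, (if (Finset.univ.filter fun t : Fin 4 => f t = i).card = 1 then (0 : ℝ) else 1)) ≤ 16 * (k : ℝ) ^ 2 := by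
  -- the summand is the indicator of `S = {f | no fibre of size 1}`
  set S : Finset (Fin 4 → Fin k) := Finset.univ.filter fun f => ∀ i : Fin k, (Finset.univ.filter fun t : Fin 4 => f t = i).card ≠ 1 with hS
  have hterm : ∀ f : Fin 4 → Fin k, (∏ i : Fin k, (if (Finset.univ.filter fun t : Fin 4 => f t = i).card = 1 then (0 : ℝ) else 1)) =
      if f ∈ S then 1 else 0 := by
    intro f
    by_cases hf : f ∈ S
    · rw [if_pos hf]
      refine Finset.prod_eq_one fun i _ => ?_
      rw [if_neg ((Finset.mem_filter.1 hf).2 i)]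
    · rw [if_neg hf]
      have : ∃ i : Fin k, (Finset.univ.filter fun t : Fin 4 => f t = i).card = 1 := by
        by_contra h
        push Not at h
        exact hf (Finset.mem_filter.2 ⟨Finset.mem_univ _, h⟩)
      obtain ⟨i, hi⟩ := this
      exact Finset.prod_eq_zero (Finset.mem_univ i) (by rw [if_pos hi])
  rw [Finset.sum_congr rfl fun f _ => hterm f, ← Finset.sum_filter, Finset.sum_const, nsmul_eq_mul, mul_one, Finset.filter_mem_eq_inter,
    Finset.univ_inter]
  -- `S ⊆ ⋃_{(i,j)} A i j` with `A i j = {f | ∀ t, f t = i ∨ f t = j}`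
  set A : Fin k × Fin k → Finset (Fin 4 → Fin k) := fun ij => Finset.univ.filter fun f => ∀ t, f t = ij.1 ∨ f t = ij.2 with hA
  have hsub : S ⊆ (Finset.univ : Finset (Fin k × Fin k)).biUnion A := by
    intro f hf
    have hf' := (Finset.mem_filter.1 hf).2
    rw [Finset.mem_biUnion]
    -- the fibre of `i := f 0` has at least two elements
    have hfib : ∀ i : Fin k, (∃ t, f t = i) → 2 ≤ (Finset.univ.filter fun t : Fin 4 => f t = i).card := by
      rintro i ⟨t, ht⟩
      have h1 : 1 ≤ (Finset.univ.filter fun t : Fin 4 => f t = i).card :=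
        Finset.card_pos.2 ⟨t, Finset.mem_filter.2 ⟨Finset.mem_univ _, ht⟩⟩
      have h2 := hf' i
      omega
    by_cases hall : ∀ t, f t = f 0
    · exact ⟨(f 0, f 0), Finset.mem_univ _, Finset.mem_filter.2 ⟨Finset.mem_univ _, fun t => Or.inl (hall t)⟩⟩
    · push Not at hall
      obtain ⟨t₁, ht₁⟩ := hall
      refine ⟨(f 0, f t₁), Finset.mem_univ _, Finset.mem_filter.2 ⟨Finset.mem_univ _, fun t => ?_⟩⟩
      -- the two fibres are disjoint, each of size ≥ 2, inside `Fin 4`: they cover everything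
      by_contra hnot
      push Not at hnot
      have hi := hfib (f 0) ⟨0, rfl⟩
      have hj := hfib (f t₁) ⟨t₁, rfl⟩
      have hdisj : Disjoint (Finset.univ.filter fun t : Fin 4 => f t = f 0) (Finset.univ.filter fun t : Fin 4 => f t = f t₁) := by
        rw [Finset.disjoint_filter]; intro t _ h1 h2; exact ht₁ (h2.symm.trans h1)
      have hunion : ((Finset.univ.filter fun t : Fin 4 => f t = f 0) ∪ (Finset.univ.filter fun t : Fin 4 => f t = f t₁)).card ≤
          (Finset.univ.erase t).card := by
        refine Finset.card_le_card fun s hs => ?_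
        rw [Finset.mem_erase]
        refine ⟨?_, Finset.mem_univ _⟩
        rintro rfl
        rcases Finset.mem_union.1 hs with h | h
        · exact hnot.1 (Finset.mem_filter.1 h).2
        · exact hnot.2 (Finset.mem_filter.1 h).2
      have hcard := Finset.card_union_add_card_inter (Finset.univ.filter fun t : Fin 4 => f t = f 0) (Finset.univ.filter fun t : Fin 4 => f t = f t₁)
      rw [Finset.disjoint_iff_inter_eq_empty.1 hdisj, Finset.card_empty, add_zero] at hcard
      rw [hcard, Finset.card_erase_of_mem (Finset.mem_univ t), Finset.card_univ, Fintype.card_fin] at hunion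
      omega
  -- `#A i j ≤ 16`
  have hAcard : ∀ ij : Fin k × Fin k, (A ij).card ≤ 16 := by
    intro ij
    have hinj : Set.InjOn (fun f : Fin 4 → Fin k => fun t => decide (f t = ij.1)) ↑(A ij) := by
      intro f hf g hg h
      simp only [hA, Finset.coe_filter, Set.mem_setOf_eq, Finset.mem_univ, true_and] at hf hg
      funext t
      have ht : (f t = ij.1 ↔ g t = ij.1) := by
        have := congrFun h t
        simpa using this
      by_cases h1 : f t = ij.1
      · rw [h1, ht.1 h1]
      · have hf2 : f t = ij.2 := (hf t).resolve_left h1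
        have hg2 : g t = ij.2 := (hg t).resolve_left fun h2 => h1 (ht.2 h2)
        rw [hf2, hg2]
    calc (A ij).card ≤ (Finset.univ : Finset (Fin 4 → Bool)).card := Finset.card_le_card_of_injOn _ (fun _ _ => Finset.mem_univ _) hinj
      _ = 16 := by rw [Finset.card_univ, Fintype.card_fun, Fintype.card_bool, Fintype.card_fin]; norm_num
  calc ((S.card : ℕ) : ℝ) ≤ (((Finset.univ : Finset (Fin k × Fin k)).biUnion A).card : ℝ) := by exact_mod_cast Finset.card_le_card hsub
    _ ≤ ((∑ ij : Fin k × Fin k, (A ij).card : ℕ) : ℝ) := by exact_mod_cast Finset.card_biUnion_le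
    _ ≤ ((∑ _ij : Fin k × Fin k, 16 : ℕ) : ℝ) := by exact_mod_cast Finset.sum_le_sum fun ij _ => hAcard ij
    _ = 16 * (k : ℝ) ^ 2 := by
        rw [Finset.sum_const, Finset.card_univ, Fintype.card_prod, Fintype.card_fin, smul_eq_mul]; push_cast; ring

/-! ## §3 The stub: `p^{(k)}_4(e,e) ≤ 16/k²` -/

/-- The base bound for the product formula: `W_𝔊(m)(x, x) ≤ 4^m · [m ≠ 1]` on `Cay(𝔊; a,b,c,d)` (no loops; `4`-regular). [cite: Woess2000, §1.B] -/
theorem card_closedWalks_stdCay_le (m : ℕ) (x : ↥grigorchukGroup) :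
    (Fintype.card {p : stdCay.Walk x x // p.length = m} : ℝ) ≤ 4 ^ m * (if m = 1 then (0 : ℝ) else 1) := by
  by_cases hm : m = 1
  · subst hm; rw [card_walks_one_self]; simp
  · rw [if_neg hm, mul_one]
    exact_mod_cast card_walks_le_pow stdCay (fun u => stdCay_degree u) m x x

/-- **`SmallParam 16` — the small parameter of the W4 skeleton, DISCHARGED: `p^{(k)}_4(e, e) ≤ 16 / k²` on `Cay(𝔊^k; std)` for every `k ≥ 1`** (KERNEL,
unconditional; walk combinatorics only: the product formula's bound form, no loops in `Cay(𝔊)`, and the count of four-step allocations with no singleton coordinate).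
The skeleton's `stub_smallParam` in the binder-repaired reading `∃ A, SmallParam A` (p3 g42 b2) is `smallParam_holds`.  Nothing about `θ(p_c)` or OIRB on any
`Cay(𝔊^k)`. [cite: Woess2000, §1.B (p⁽ⁿ⁾ and walk counts)] [cite: HeydenreichVanDerHofstad2017, §5.2 (the small parameter)] [cite: BenjaminiSchramm1996, §2 (Cayley graphs)] -/
theorem smallParam_sixteen : SmallParam 16 := by
  intro k hk
  have hkpos : (0 : ℝ) < (k : ℝ) := by exact_mod_cast hk
  have hd : 0 < 4 * k := by omega
  have hW := card_closedWalks_gkCay_le k 4 1 (fun m => if m = 1 then (0 : ℝ) else 1) card_closedWalks_stdCay_le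
  have hcount := sum_prod_noSingleton_le k
  have h256 : (4 : ℝ) ^ 4 = 256 := by norm_num
  rw [h256] at hW
  -- the walk count, as a real number (one name for the `Fintype.card` term of the product formula's bound)
  obtain ⟨W, hWdef, hW1⟩ : ∃ W : ℝ, (Fintype.card {p : (gkCay k).Walk 1 1 // p.length = 4} : ℝ) = W ∧ W ≤ 4096 * (k : ℝ) ^ 2 :=
    ⟨_, rfl, hW.trans (by linarith [hcount])⟩
  rw [simpleStep_eq_card_walks_div (gkCay k) (gkCay_isRegularOfDegree k) hd 4 1 1, hWdef,
    div_le_div_iff₀ (by positivity) (by positivity)]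
  push_cast
  have h2 : (16 : ℝ) * (4 * (k : ℝ)) ^ 4 = 4096 * (k : ℝ) ^ 2 * (k : ℝ) ^ 2 := by ring
  rw [h2]
  exact mul_le_mul_of_nonneg_right hW1 (sq_nonneg _)

/-- **`stub_smallParam` discharged in the skeleton's reading**: `∃ A, SmallParam A` (with `A = 16`). [cite: HeydenreichVanDerHofstad2017, §5.2 (the small parameter)] -/
theorem smallParam_holds : ∃ A : ℝ, SmallParam A := ⟨16, smallParam_sixteen⟩

end NcHaraSlade

end Grigorchuk

end Summit.CriticalPhenomena.PercolationContinuityZ3.Theorems.Transplant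

end
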